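import Summits.ResolutionOfSingularities.ResolutionOfSingularities.Theorems.WeightedInvariantWeightedConstructionFatPair

/-!
# Fat-pair escape: no datum's centre sits on the smaller fat point of every pair `Fₙ₊₁ ⊔ Fₙ₊₂`

[OURS · L1 W4.3 · chain w43, stub worker 4] Kernel form of the ESCAPE-CHAIN finding (2026-08-26,
`L/res-L1-w43-stub-4/FINDING-stub-recoding.md`, evidence on stmt-ResolutionOfSingularities-0571) for crux
`WeightedConstruction`: interface point (γ) of `Cruxes/WeightedConstruction/STRATEGY-CENSUS.md` §6
(«one well-ordered `Γ` for all dimensions + `(i)` + `(iii)`»), door census (T1) of `L/w43/CHAIN.md`.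
NOT a statement of any manuscript. Geometry of the pairs: `Theorems/…FatPair.lean`.

* `ACChartPreDatum.inv_fatPair_inl/inr`: TRANSFER — by axiom `(i)` along the open immersions
  `Fₘ ↪ T(m, m') ↩ Fₘ'`, `inv` of the pair at either origin is `inv` of that fat point at its origin.
* `ACChartPreDatum.inv_fatPoint_lt_of_centre_support_fatPair`: ONE PAIR — if the centre of `D` on
  `T(m, m')` is supported exactly on `{inl 0ₘ}` then `inv(Fₘ', 0) < inv(Fₘ, 0)` (axiom `(ii)` makes the
  singular origin a guard, axiom `(iii)` puts the other origin strictly below, then transfer).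
* `ACChartPreDatum.fatPairEscape` (+ `weightedResolutionDatum_fatPairEscape`): ESCAPE — over any perfect
  field of characteristic `p`, NO algebraically-closed-chart pre-datum (a fortiori no
  `WeightedResolutionDatum p`) has its centre supported exactly on `{inl 0ₙ₊₁}` on every pair
  `T(n+1, n+2)`: the values `inv(Fₙ₊₁, 0)` would strictly descend in the well-ordered `Γ`
  (lead a2's lever `WeightedResolutionDatum_no_centreEscapeChain`, with the chain now CONSTRUCTED).
* `LexmaxHullRule.fatPairEscape` (+ `_datum`) and `LexmaxHullRule.not_exists_datum_centre_support_eq`: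
  since every rule `R : LexmaxHullRule p` with `R.HullComap` IS centred on `{inl 0ₙ₊₁}` on these pairs
  (`centre_support_fatPair`), no datum has centre support equal to the rule's centre support on all pairs
  of the regime — the transfer stub `stub_recoding` of the retired line `pointwise-lexmax-hull` admits
  no proof through `centre := R.centre` under the current typing of `WeightedResolutionDatum` (for
  `p = 2` this is moot by tri-2's REFUTE-L1, `LexmaxHullRule 2` being empty; the datum-level statements
  `ACChartPreDatum.fatPairEscape` / `weightedResolutionDatum_fatPairEscape` do not mention the rule).
-/

noncomputable section

open CategoryTheory CategoryTheory.Limits AlgebraicGeometry Topology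
open Literature.AlgebraicGeometry.Resolution

set_option linter.dupNamespace false -- mandated namespace of this single-conjunct summit

/-! ## The datum on the fat pairs: transfer and escape -/

namespace Summit.ResolutionOfSingularities.ResolutionOfSingularities.Theorems

open PointwiseLexmaxHull

namespace ACChartPreDatum

variable {p : ℕ} (D : ACChartPreDatum p) (k : Type) [Field k] [CharP k p] [PerfectField k]

/-- **Transfer along the left half**: `inv` of the pair `T(m, m')` at the left origin is `inv` of the
fat point `Fₘ` at its origin (axiom `(i)` for the open immersion `Spec fst`). [OURS · folklore] -/
theorem inv_fatPair_inl (m m' : ℕ) :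
    D.inv (Spec.map (CommRingCat.ofHom
        (algebraMap k (MvPolynomial (Fin m) k × MvPolynomial (Fin m') k))))
      (Scheme.IdealSheafData.ofIdealTop
        ((((RingHom.ker (MvPolynomial.constantCoeff : MvPolynomial (Fin m) k →+* k)) ^ 2).prod
            ((RingHom.ker (MvPolynomial.constantCoeff : MvPolynomial (Fin m') k →+* k)) ^ 2)).map
          (Scheme.ΓSpecIso (.of (MvPolynomial (Fin m) k × MvPolynomial (Fin m') k))).inv.hom))
      (Spec.map (CommRingCat.ofHom (RingHom.fst _ _))
          (⟨RingHom.ker (MvPolynomial.constantCoeff : MvPolynomial (Fin m) k →+* k),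
            RingHom.ker_isPrime _⟩ : Spec (.of (MvPolynomial (Fin m) k)))) =
    D.inv (Spec.map (CommRingCat.ofHom (algebraMap k (MvPolynomial (Fin m) k))))
      (Scheme.IdealSheafData.ofIdealTop
        (((RingHom.ker (MvPolynomial.constantCoeff : MvPolynomial (Fin m) k →+* k)) ^ 2).map
          (Scheme.ΓSpecIso (.of (MvPolynomial (Fin m) k))).inv.hom))
      ⟨RingHom.ker (MvPolynomial.constantCoeff : MvPolynomial (Fin m) k →+* k),
        RingHom.ker_isPrime _⟩ := by
  set A := MvPolynomial (Fin m) k with hA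
  set B := MvPolynomial (Fin m') k with hB
  have hsA : Smooth (Spec.map (CommRingCat.ofHom (algebraMap k A))) :=
    DatumToEmbedded.Negative.smooth_affineSpace k m
  have hsB : Smooth (Spec.map (CommRingCat.ofHom (algebraMap k B))) :=
    DatumToEmbedded.Negative.smooth_affineSpace k m'
  haveI := hsA
  haveI := hsB
  haveI : Smooth (Spec.map (CommRingCat.ofHom (algebraMap k (A × B)))) :=
    smooth_specMap_algebraMap_prod A B k hsA hsB
  haveI := isOpenImmersion_specMap_fst A B
  rw [← D.inv_comap (Spec.map (CommRingCat.ofHom (algebraMap k (A × B))))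
    (Spec.map (CommRingCat.ofHom (algebraMap k A))) (Spec.map (CommRingCat.ofHom (RingHom.fst A B)))
    (specMap_fst_comp_specMap_algebraMap A B k), comap_specMap_fst_ofIdealTop_prod]

/-- **Transfer along the right half**: `inv` of the pair `T(m, m')` at the right origin is `inv` of the
fat point `Fₘ'` at its origin (axiom `(i)` for the open immersion `Spec snd`). [OURS · folklore] -/
theorem inv_fatPair_inr (m m' : ℕ) :
    D.inv (Spec.map (CommRingCat.ofHom
        (algebraMap k (MvPolynomial (Fin m) k × MvPolynomial (Fin m') k))))
      (Scheme.IdealSheafData.ofIdealTop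
        ((((RingHom.ker (MvPolynomial.constantCoeff : MvPolynomial (Fin m) k →+* k)) ^ 2).prod
            ((RingHom.ker (MvPolynomial.constantCoeff : MvPolynomial (Fin m') k →+* k)) ^ 2)).map
          (Scheme.ΓSpecIso (.of (MvPolynomial (Fin m) k × MvPolynomial (Fin m') k))).inv.hom))
      (Spec.map (CommRingCat.ofHom (RingHom.snd _ _))
          (⟨RingHom.ker (MvPolynomial.constantCoeff : MvPolynomial (Fin m') k →+* k),
            RingHom.ker_isPrime _⟩ : Spec (.of (MvPolynomial (Fin m') k)))) =
    D.inv (Spec.map (CommRingCat.ofHom (algebraMap k (MvPolynomial (Fin m') k))))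
      (Scheme.IdealSheafData.ofIdealTop
        (((RingHom.ker (MvPolynomial.constantCoeff : MvPolynomial (Fin m') k →+* k)) ^ 2).map
          (Scheme.ΓSpecIso (.of (MvPolynomial (Fin m') k))).inv.hom))
      ⟨RingHom.ker (MvPolynomial.constantCoeff : MvPolynomial (Fin m') k →+* k),
        RingHom.ker_isPrime _⟩ := by
  set A := MvPolynomial (Fin m) k with hA
  set B := MvPolynomial (Fin m') k with hB
  have hsA : Smooth (Spec.map (CommRingCat.ofHom (algebraMap k A))) :=
    DatumToEmbedded.Negative.smooth_affineSpace k m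
  have hsB : Smooth (Spec.map (CommRingCat.ofHom (algebraMap k B))) :=
    DatumToEmbedded.Negative.smooth_affineSpace k m'
  haveI := hsA
  haveI := hsB
  haveI : Smooth (Spec.map (CommRingCat.ofHom (algebraMap k (A × B)))) :=
    smooth_specMap_algebraMap_prod A B k hsA hsB
  haveI := isOpenImmersion_specMap_snd A B
  rw [← D.inv_comap (Spec.map (CommRingCat.ofHom (algebraMap k (A × B))))
    (Spec.map (CommRingCat.ofHom (algebraMap k B))) (Spec.map (CommRingCat.ofHom (RingHom.snd A B)))
    (specMap_snd_comp_specMap_algebraMap A B k), comap_specMap_snd_ofIdealTop_prod]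

/-- **One pair**: if the centre of `D` on `T(m, m')` (`1 ≤ m, m'`) is supported exactly on the left
origin, then `inv` of the fat point `Fₘ'` is strictly below `inv` of the fat point `Fₘ` (axioms `(ii)`,
`(iii)` on the pair, then transfer `(i)`). [OURS · folklore] -/
theorem inv_fatPoint_lt_of_centre_support_fatPair {m m' : ℕ} (hm : 1 ≤ m) (hm' : 1 ≤ m')
    (hsupp : (D.centre (Spec.map (CommRingCat.ofHom
        (algebraMap k (MvPolynomial (Fin m) k × MvPolynomial (Fin m') k))))
      (Scheme.IdealSheafData.ofIdealTop
        ((((RingHom.ker (MvPolynomial.constantCoeff : MvPolynomial (Fin m) k →+* k)) ^ 2).prod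
            ((RingHom.ker (MvPolynomial.constantCoeff : MvPolynomial (Fin m') k →+* k)) ^ 2)).map
          (Scheme.ΓSpecIso (.of (MvPolynomial (Fin m) k × MvPolynomial (Fin m') k))).inv.hom))).support =
      {Spec.map (CommRingCat.ofHom (RingHom.fst _ _))
          (⟨RingHom.ker (MvPolynomial.constantCoeff : MvPolynomial (Fin m) k →+* k),
            RingHom.ker_isPrime _⟩ : Spec (.of (MvPolynomial (Fin m) k)))}) :
    D.inv (Spec.map (CommRingCat.ofHom (algebraMap k (MvPolynomial (Fin m') k))))
      (Scheme.IdealSheafData.ofIdealTop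
        (((RingHom.ker (MvPolynomial.constantCoeff : MvPolynomial (Fin m') k →+* k)) ^ 2).map
          (Scheme.ΓSpecIso (.of (MvPolynomial (Fin m') k))).inv.hom))
      ⟨RingHom.ker (MvPolynomial.constantCoeff : MvPolynomial (Fin m') k →+* k),
        RingHom.ker_isPrime _⟩ <
    D.inv (Spec.map (CommRingCat.ofHom (algebraMap k (MvPolynomial (Fin m) k))))
      (Scheme.IdealSheafData.ofIdealTop
        (((RingHom.ker (MvPolynomial.constantCoeff : MvPolynomial (Fin m) k →+* k)) ^ 2).map
          (Scheme.ΓSpecIso (.of (MvPolynomial (Fin m) k))).inv.hom))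
      ⟨RingHom.ker (MvPolynomial.constantCoeff : MvPolynomial (Fin m) k →+* k),
        RingHom.ker_isPrime _⟩ := by
  set A := MvPolynomial (Fin m) k with hA
  set B := MvPolynomial (Fin m') k with hB
  have hsA : Smooth (Spec.map (CommRingCat.ofHom (algebraMap k A))) :=
    DatumToEmbedded.Negative.smooth_affineSpace k m
  have hsB : Smooth (Spec.map (CommRingCat.ofHom (algebraMap k B))) :=
    DatumToEmbedded.Negative.smooth_affineSpace k m'
  haveI : Smooth (Spec.map (CommRingCat.ofHom (algebraMap k (A × B)))) :=
    smooth_specMap_algebraMap_prod A B k hsA hsB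
  have has := (xSing_fatPair_iff k hm hm' _).mpr (Or.inl rfl)
  have hne := specMap_fst_ne_specMap_snd A B
    ⟨RingHom.ker (MvPolynomial.constantCoeff : A →+* k), RingHom.ker_isPrime _⟩
    ⟨RingHom.ker (MvPolynomial.constantCoeff : B →+* k), RingHom.ker_isPrime _⟩
  rw [← D.inv_fatPair_inl k m m', ← D.inv_fatPair_inr k m m']
  refine D.inv_lt_of_not_mem_support_centre _ _ ⟨_, D.not_isBot_inv_of_xSing _ _ has⟩ ?_ ?_
  · rw [hsupp]
    exact Set.mem_singleton _
  · rw [hsupp, Set.mem_singleton_iff]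
    exact fun h => hne h.symm

/-- **FAT-PAIR ESCAPE (pre-datum).** Over a perfect field `k` of characteristic `p`, no
algebraically-closed-chart pre-datum has its centre supported exactly on the left origin of EVERY fat
pair `T(n+1, n+2)`, `n : ℕ`: the values `inv(Fₙ₊₁, 0)` would strictly descend in the well-ordered `Γ`.
[OURS · folklore] -/
theorem fatPairEscape
    (hsupp : ∀ n : ℕ, (D.centre (Spec.map (CommRingCat.ofHom
        (algebraMap k (MvPolynomial (Fin (n + 1)) k × MvPolynomial (Fin (n + 2)) k))))
      (Scheme.IdealSheafData.ofIdealTop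
        ((((RingHom.ker (MvPolynomial.constantCoeff : MvPolynomial (Fin (n + 1)) k →+* k)) ^ 2).prod
            ((RingHom.ker (MvPolynomial.constantCoeff : MvPolynomial (Fin (n + 2)) k →+* k)) ^ 2)).map
          (Scheme.ΓSpecIso
            (.of (MvPolynomial (Fin (n + 1)) k × MvPolynomial (Fin (n + 2)) k))).inv.hom))).support =
      {Spec.map (CommRingCat.ofHom (RingHom.fst _ _))
          (⟨RingHom.ker (MvPolynomial.constantCoeff : MvPolynomial (Fin (n + 1)) k →+* k),
            RingHom.ker_isPrime _⟩ : Spec (.of (MvPolynomial (Fin (n + 1)) k)))}) :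
    False := by
  obtain ⟨n, hn⟩ := WellFounded.not_rel_apply_succ (r := (· < ·)) (fun n : ℕ =>
    D.inv (Spec.map (CommRingCat.ofHom (algebraMap k (MvPolynomial (Fin (n + 1)) k))))
      (Scheme.IdealSheafData.ofIdealTop
        (((RingHom.ker (MvPolynomial.constantCoeff : MvPolynomial (Fin (n + 1)) k →+* k)) ^ 2).map
          (Scheme.ΓSpecIso (.of (MvPolynomial (Fin (n + 1)) k))).inv.hom))
      ⟨RingHom.ker (MvPolynomial.constantCoeff : MvPolynomial (Fin (n + 1)) k →+* k),
        RingHom.ker_isPrime _⟩)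
  exact hn (D.inv_fatPoint_lt_of_centre_support_fatPair k (Nat.succ_pos n) (Nat.succ_pos (n + 1))
    (hsupp n))

end ACChartPreDatum

/-- **FAT-PAIR ESCAPE (datum).** The same for a full `WeightedResolutionDatum p`. [OURS · folklore] -/
theorem weightedResolutionDatum_fatPairEscape {p : ℕ} (D : WeightedResolutionDatum p)
    (k : Type) [Field k] [CharP k p] [PerfectField k]
    (hsupp : ∀ n : ℕ, (D.centre (Spec.map (CommRingCat.ofHom
        (algebraMap k (MvPolynomial (Fin (n + 1)) k × MvPolynomial (Fin (n + 2)) k))))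
      (Scheme.IdealSheafData.ofIdealTop
        ((((RingHom.ker (MvPolynomial.constantCoeff : MvPolynomial (Fin (n + 1)) k →+* k)) ^ 2).prod
            ((RingHom.ker (MvPolynomial.constantCoeff : MvPolynomial (Fin (n + 2)) k →+* k)) ^ 2)).map
          (Scheme.ΓSpecIso
            (.of (MvPolynomial (Fin (n + 1)) k × MvPolynomial (Fin (n + 2)) k))).inv.hom))).support =
      {Spec.map (CommRingCat.ofHom (RingHom.fst _ _))
          (⟨RingHom.ker (MvPolynomial.constantCoeff : MvPolynomial (Fin (n + 1)) k →+* k),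
            RingHom.ker_isPrime _⟩ : Spec (.of (MvPolynomial (Fin (n + 1)) k)))}) :
    False :=
  (ACChartPreDatum.ofPreDatum (PreDatum.ofDatum D)).fatPairEscape k hsupp

end Summit.ResolutionOfSingularities.ResolutionOfSingularities.Theorems

namespace Summit.ResolutionOfSingularities.ResolutionOfSingularities.Theorems.PointwiseLexmaxHull

namespace LexmaxHullRule

variable {p : ℕ} (R : LexmaxHullRule p)

/-- **FAT-PAIR ESCAPE FOR THE RULE (pre-datum).** For every rule `R` with `R.HullComap` and every
algebraically-closed-chart pre-datum `D`, over any perfect field of characteristic `p`: the supports of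
`D`'s centre and of `R`'s centre cannot agree on every fat pair `T(n+1, n+2)`. [OURS · folklore] -/
theorem fatPairEscape (hR : R.HullComap) (D : ACChartPreDatum p)
    (k : Type) [Field k] [CharP k p] [PerfectField k]
    (hagree : ∀ n : ℕ,
      (D.centre (Spec.map (CommRingCat.ofHom
          (algebraMap k (MvPolynomial (Fin (n + 1)) k × MvPolynomial (Fin (n + 2)) k))))
        (Scheme.IdealSheafData.ofIdealTop
          ((((RingHom.ker (MvPolynomial.constantCoeff : MvPolynomial (Fin (n + 1)) k →+* k)) ^ 2).prod
              ((RingHom.ker (MvPolynomial.constantCoeff : MvPolynomial (Fin (n + 2)) k →+* k)) ^ 2)).map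
            (Scheme.ΓSpecIso
              (.of (MvPolynomial (Fin (n + 1)) k × MvPolynomial (Fin (n + 2)) k))).inv.hom))).support =
      (R.centre (Spec.map (CommRingCat.ofHom
          (algebraMap k (MvPolynomial (Fin (n + 1)) k × MvPolynomial (Fin (n + 2)) k))))
        (Scheme.IdealSheafData.ofIdealTop
          ((((RingHom.ker (MvPolynomial.constantCoeff : MvPolynomial (Fin (n + 1)) k →+* k)) ^ 2).prod
              ((RingHom.ker (MvPolynomial.constantCoeff : MvPolynomial (Fin (n + 2)) k →+* k)) ^ 2)).map
            (Scheme.ΓSpecIso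
              (.of (MvPolynomial (Fin (n + 1)) k × MvPolynomial (Fin (n + 2)) k))).inv.hom))).support) :
    False :=
  D.fatPairEscape k fun n =>
    (hagree n).trans (R.centre_support_fatPair hR k (Nat.succ_pos n) (Nat.lt_succ_self (n + 1)))

/-- **FAT-PAIR ESCAPE FOR THE RULE (datum).** [OURS · folklore] -/
theorem fatPairEscape_datum (hR : R.HullComap) (D : WeightedResolutionDatum p)
    (k : Type) [Field k] [CharP k p] [PerfectField k]
    (hagree : ∀ n : ℕ,
      (D.centre (Spec.map (CommRingCat.ofHom
          (algebraMap k (MvPolynomial (Fin (n + 1)) k × MvPolynomial (Fin (n + 2)) k))))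
        (Scheme.IdealSheafData.ofIdealTop
          ((((RingHom.ker (MvPolynomial.constantCoeff : MvPolynomial (Fin (n + 1)) k →+* k)) ^ 2).prod
              ((RingHom.ker (MvPolynomial.constantCoeff : MvPolynomial (Fin (n + 2)) k →+* k)) ^ 2)).map
            (Scheme.ΓSpecIso
              (.of (MvPolynomial (Fin (n + 1)) k × MvPolynomial (Fin (n + 2)) k))).inv.hom))).support =
      (R.centre (Spec.map (CommRingCat.ofHom
          (algebraMap k (MvPolynomial (Fin (n + 1)) k × MvPolynomial (Fin (n + 2)) k))))
        (Scheme.IdealSheafData.ofIdealTop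
          ((((RingHom.ker (MvPolynomial.constantCoeff : MvPolynomial (Fin (n + 1)) k →+* k)) ^ 2).prod
              ((RingHom.ker (MvPolynomial.constantCoeff : MvPolynomial (Fin (n + 2)) k →+* k)) ^ 2)).map
            (Scheme.ΓSpecIso
              (.of (MvPolynomial (Fin (n + 1)) k × MvPolynomial (Fin (n + 2)) k))).inv.hom))).support) :
    False :=
  R.fatPairEscape hR (ACChartPreDatum.ofPreDatum (PreDatum.ofDatum D)) k hagree

/-- **No datum's centre has the support of the rule's centre throughout the regime** (`p` prime; witness
field `𝔽_p`): for every rule `R : LexmaxHullRule p` with `R.HullComap` there is NO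
`WeightedResolutionDatum p` whose centre support equals `R`'s centre support (= the maximum locus of
`R.hull`) on every pair `(Y → Spec k, X)` of the regime with a singular point — the transfer stub
`stub_recoding` of the retired line `pointwise-lexmax-hull` admits no proof through `centre := R.centre`.
[OURS · folklore] -/
theorem not_exists_datum_centre_support_eq (hR : R.HullComap) [Fact p.Prime] :
    ¬ ∃ D : WeightedResolutionDatum p,
      ∀ ⦃k : Type⦄ [Field k] [CharP k p] [PerfectField k] ⦃Y : Scheme.{0}⦄
        (f : Y ⟶ Spec (.of k)) [Smooth f] [IsSeparated f] [QuasiCompact f] (X : Y.IdealSheafData),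
        (∃ y : Y, XSing X y) → (D.centre f X).support = (R.centre f X).support := by
  rintro ⟨D, hD⟩
  refine R.fatPairEscape_datum hR D (ZMod p) fun n => ?_
  set A := MvPolynomial (Fin (n + 1)) (ZMod p) with hA
  set B := MvPolynomial (Fin (n + 2)) (ZMod p) with hB
  have hsA : Smooth (Spec.map (CommRingCat.ofHom (algebraMap (ZMod p) A))) :=
    DatumToEmbedded.Negative.smooth_affineSpace (ZMod p) (n + 1)
  have hsB : Smooth (Spec.map (CommRingCat.ofHom (algebraMap (ZMod p) B))) :=
    DatumToEmbedded.Negative.smooth_affineSpace (ZMod p) (n + 2)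
  haveI : Smooth (Spec.map (CommRingCat.ofHom (algebraMap (ZMod p) (A × B)))) :=
    smooth_specMap_algebraMap_prod A B (ZMod p) hsA hsB
  exact hD _ _ ⟨_, (xSing_fatPair_iff (ZMod p) (Nat.succ_pos n) (Nat.succ_pos (n + 1)) _).mpr
    (Or.inl rfl)⟩

end LexmaxHullRule

end Summit.ResolutionOfSingularities.ResolutionOfSingularities.Theorems.PointwiseLexmaxHull

end
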